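import Summits.Ventures.YMGap.Thresholds.PolyFluxField
import Summits.QuantumFields.BalabanUV.InfraRed.StrongCouplingFluxLambda
import HarnessLib

/-!
# Venture YMGap, track (a) / A4 kernel port, Stage 2 — the flux side `|p|·Y + X` of the polynomial-profile field and its
# λ-bounds `Y ≤ (λ m₂ + H/λ)/2`, `X ≤ (λ z_B + Q/λ)/2`

HONEST FRAMING: venture file of the cell `pub-ymgap` (QuantumFields programme), the `FluxLambda` analogue for the polynomial-profile
flux field of `PolyFluxField` (engine-2's small-divergence witness, PLAN R78 Stage 2).  Pure [folklore] calculus/measure bookkeeping,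
kernel-proved; NO certificate, NO number, NO covariance bound or threshold is claimed here, and nothing about Yang–Mills beyond
strong-coupling bookkeeping.  It generalises pub-balaban's leaf (21) `StrongCouplingFluxLambda` (quadratic divergence profile) to an
ARBITRARY continuous divergence profile `φ` and an arbitrary continuous field for the size term:
* `fluxRHS_eq_of_profile`: if `radialDiv W (y) = |y|² e^{κy₀}·p·φ(y₀)` for all `y` (the shape `radialDiv_polyFluxField_tied` delivers when
  `Re d′ = 0`) then the flux side of lemma F′ (`abs_integral_lipschitz_mul_inner_le`),
  `∫₀¹ (r² ∫ |radialDiv W (r x)| dσ + r³ ∫ ‖W (r x)‖ dσ) dr`, equals `|p|·Y(φ) + X` with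
  `Y(φ) = ∫₀¹ r⁴ ∫ e^{κ r x₀} |φ(r x₀)| dσ dr`, `X = ∫₀¹ r³ ∫ e^{κ r x₀} ‖V(r x)‖ dσ dr` (`W = e^{κy₀}V`, `V = profileField d′ p P Q`);
* `fluxRHS_eq_cubic`: the instance for the cubic witness (`P = cubicProfile a`, `Q = tiedProfile τ a`, `Re d′ = 0`), with `φ = h` the explicit
  degree-5 small-divergence polynomial of `radialDiv_cubicFluxField`;
* `Y_le_of_profile`: for every continuous `φ` and `λ > 0`, `Y(φ) ≤ (λ·m₂ + H(φ)/λ)/2`, `m₂ = ∫₀¹ r⁵ ∫ e^{κrx₀}`, `H(φ) = ∫₀¹ r³ ∫ e^{κrx₀} φ(rx₀)²`;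
* `X_le_of_field`: for every continuous `V : ℍ → ℍ` and `λ > 0`, `X(V) ≤ (λ·z_B + Q(V)/λ)/2`, `z_B = ∫₀¹ r³ ∫ e^{κrx₀}`, `Q(V) = ∫₀¹ r³ ∫ e^{κrx₀}‖V(rx)‖²`
(pointwise AM–GM under both integral signs, leaf (21)'s `amgm_abs`).  The ball-moment expansions of `H(h)` and `Q(V)` (`H_expand`/`Q_expand`
analogues) and the piece certificates are engine-2's.  NOT CLAIMED: any number.
-/

noncomputable section

open MeasureTheory Filter Finset Real
open scoped NNReal Quaternion Matrix ComplexConjugate BigOperators Matrix.Norms.Frobenius ContDiff Topology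
  RealInnerProductSpace
open Matrix Complex
open Literature.MathematicalPhysics.QuantumLattice (su2Quat quatMatrix quatMatrix_mul quatMatrix_su2Quat norm_su2Quat)
open Literature.MathematicalPhysics.QuantumFieldTheory
open Literature.MathematicalPhysics.QuantumFieldTheory.SUNBakryEmery
open Literature.MathematicalPhysics.QuantumFieldTheory.Balaban1983to89.StrongCouplingVarianceWindow (qI qJ qK)

namespace Summit.Ventures.YMGap.PolyFluxLambda

open Summit.QuantumFields.BalabanUV.InfraRed.StrongCouplingSphereCalculus (radialDiv quatOfMat quatOfMat_coe)
open Summit.QuantumFields.BalabanUV.InfraRed.StrongCouplingFluxMoments (continuous_integral₂)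
open Summit.QuantumFields.BalabanUV.InfraRed.StrongCouplingFluxLambda (exp_smul_re amgm_abs)
open Summit.Ventures.YMGap.PolyFluxField

/-! ## 0. Continuity plumbing (private copies, as in leaf (21)) -/

/-- Continuity of `su2Quat`. [folklore] -/
private theorem cq1 : Continuous fun g : Matrix.specialUnitaryGroup (Fin 2) ℂ => su2Quat g := by
  have h : Continuous fun g : Matrix.specialUnitaryGroup (Fin 2) ℂ => quatOfMat (g : Matrix (Fin 2) (Fin 2) ℂ) :=
    (LinearMap.continuous_of_finiteDimensional quatOfMat).comp continuous_subtype_val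
  simpa only [quatOfMat_coe] using h

/-- Continuity of the coordinate `x₀`. [folklore] -/
private theorem cq2 : Continuous fun g : Matrix.specialUnitaryGroup (Fin 2) ℂ => (su2Quat g).re :=
  Quaternion.continuous_re.comp cq1

/-- Joint continuity plumbing: `(r, g) ↦ x_g`. [folklore] -/
private theorem cp1 : Continuous fun p : ℝ × Matrix.specialUnitaryGroup (Fin 2) ℂ => su2Quat p.2 :=
  cq1.comp continuous_snd

/-- Joint continuity plumbing: `(r, g) ↦ (x_g)₀`. [folklore] -/
private theorem cp2 : Continuous fun p : ℝ × Matrix.specialUnitaryGroup (Fin 2) ℂ => (su2Quat p.2).re :=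
  cq2.comp continuous_snd

/-! ## 1. The flux functional `∫₀¹ (r² ∫|radialDiv W| + r³ ∫‖W‖) = |p|·Y(φ) + X` -/

/-- **The flux functional of a field `W = e^{κy₀}·V` whose frame divergence has the profile form `radialDiv W (y) = |y|² e^{κy₀} p φ(y₀)`**
(`φ` continuous, `V` continuous): `∫₀¹ (r² ∫ |radialDiv W(rx)| dσ + r³ ∫ ‖W(rx)‖ dσ) dr = |p|·Y(φ) + X` with
`Y(φ) = ∫₀¹ r⁴ ∫ e^{κrx₀}|φ(rx₀)| dσ dr` and `X = ∫₀¹ r³ ∫ e^{κrx₀}‖V(rx)‖ dσ dr`. [folklore] -/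
theorem fluxRHS_eq_of_profile (κ p : ℝ) {W V : ℍ → ℍ} {φ : ℝ → ℝ} (hφ : Continuous φ) (hV : Continuous V)
    (hW : ∀ y, W y = Real.exp (κ * y.re) • V y)
    (hdiv : ∀ y, radialDiv W y = ‖y‖ ^ 2 * Real.exp (κ * y.re) * (p * φ y.re)) :
    ∫ r in (0:ℝ)..1, (r ^ 2 * ∫ g, |radialDiv W (r • su2Quat g)| ∂haarProbability (Matrix.specialUnitaryGroup (Fin 2) ℂ) +
      r ^ 3 * ∫ g, ‖W (r • su2Quat g)‖ ∂haarProbability (Matrix.specialUnitaryGroup (Fin 2) ℂ)) =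
    |p| * (∫ r in (0:ℝ)..1, r ^ 4 * ∫ g,
        Real.exp (κ * r * (su2Quat g).re) * |φ (r * (su2Quat g).re)| ∂haarProbability (Matrix.specialUnitaryGroup (Fin 2) ℂ)) +
    ∫ r in (0:ℝ)..1, r ^ 3 * ∫ g,
        Real.exp (κ * r * (su2Quat g).re) * ‖V (r • su2Quat g)‖ ∂haarProbability (Matrix.specialUnitaryGroup (Fin 2) ℂ) := by
  have hq1 := cq1
  have hq := cq2
  have hp1 := cp1
  have hp := cp2
  have h1 : ∀ r : ℝ, (r ^ 2 * ∫ g, |radialDiv W (r • su2Quat g)| ∂haarProbability (Matrix.specialUnitaryGroup (Fin 2) ℂ)) =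
      |p| * (r ^ 4 * ∫ g,
        Real.exp (κ * r * (su2Quat g).re) * |φ (r * (su2Quat g).re)| ∂haarProbability (Matrix.specialUnitaryGroup (Fin 2) ℂ)) := by
    intro r
    have hpt : ∀ g : Matrix.specialUnitaryGroup (Fin 2) ℂ, |radialDiv W (r • su2Quat g)| =
        (r ^ 2 * |p|) * (Real.exp (κ * r * (su2Quat g).re) * |φ (r * (su2Quat g).re)|) := by
      intro g
      rw [hdiv, exp_smul_re, norm_smul, norm_su2Quat, mul_one, Real.norm_eq_abs, sq_abs, Quaternion.re_smul, smul_eq_mul,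
        abs_mul, abs_mul, abs_mul, abs_of_nonneg (sq_nonneg r), abs_of_pos (Real.exp_pos _)]
      ring
    simp only [hpt]
    rw [integral_const_mul]
    ring
  have h2 : ∀ r : ℝ, (r ^ 3 * ∫ g, ‖W (r • su2Quat g)‖ ∂haarProbability (Matrix.specialUnitaryGroup (Fin 2) ℂ)) =
      r ^ 3 * ∫ g, Real.exp (κ * r * (su2Quat g).re) * ‖V (r • su2Quat g)‖ ∂haarProbability (Matrix.specialUnitaryGroup (Fin 2) ℂ) := by
    intro r
    have hpt : ∀ g : Matrix.specialUnitaryGroup (Fin 2) ℂ, ‖W (r • su2Quat g)‖ =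
        Real.exp (κ * r * (su2Quat g).re) * ‖V (r • su2Quat g)‖ := by
      intro g
      rw [hW, norm_smul, Real.norm_eq_abs, abs_of_pos (Real.exp_pos _), exp_smul_re]
    simp only [hpt]
  simp only [h1, h2]
  have hVc : Continuous fun p : ℝ × Matrix.specialUnitaryGroup (Fin 2) ℂ => V (p.1 • su2Quat p.2) :=
    hV.comp (continuous_fst.smul hp1)
  have cY := continuous_integral₂ (F := fun r (g : Matrix.specialUnitaryGroup (Fin 2) ℂ) =>
    Real.exp (κ * r * (su2Quat g).re) * |φ (r * (su2Quat g).re)|) (by fun_prop)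
  have cX := continuous_integral₂ (F := fun r (g : Matrix.specialUnitaryGroup (Fin 2) ℂ) =>
    Real.exp (κ * r * (su2Quat g).re) * ‖V (r • su2Quat g)‖) (by fun_prop)
  have iY : IntervalIntegrable (fun r : ℝ => |p| * (r ^ 4 * ∫ g,
      Real.exp (κ * r * (su2Quat g).re) * |φ (r * (su2Quat g).re)| ∂haarProbability (Matrix.specialUnitaryGroup (Fin 2) ℂ)))
      volume 0 1 := (continuous_const.mul ((continuous_pow 4).mul cY)).intervalIntegrable 0 1
  have iX : IntervalIntegrable (fun r : ℝ => r ^ 3 * ∫ g,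
      Real.exp (κ * r * (su2Quat g).re) * ‖V (r • su2Quat g)‖ ∂haarProbability (Matrix.specialUnitaryGroup (Fin 2) ℂ))
      volume 0 1 := ((continuous_pow 3).mul cX).intervalIntegrable 0 1
  rw [intervalIntegral.integral_add iY iX, intervalIntegral.integral_const_mul]

/-- **The flux functional of the cubic-witness field** (`P = cubicProfile a`, `Q = tiedProfile τ a`, transverse `d′`): `|p|·Y(h) + X` with
`h(t) = (1 − t²)(a₁ + 2a₂t + 3a₃t²) + (κ(1 − t²) − 5t)(a₀ + a₁t + a₂t² + a₃t³) + κt² + (5 − κτ)t − 4τ`. [folklore] -/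
theorem fluxRHS_eq_cubic (κ : ℝ) {d' : ℍ} (hd : d'.re = 0) (p τ a₀ a₁ a₂ a₃ : ℝ) :
    ∫ r in (0:ℝ)..1, (r ^ 2 * ∫ g,
        |radialDiv (polyFluxField κ d' p (cubicProfile a₀ a₁ a₂ a₃) (tiedProfile τ a₀ a₁ a₂ a₃)) (r • su2Quat g)|
          ∂haarProbability (Matrix.specialUnitaryGroup (Fin 2) ℂ) +
      r ^ 3 * ∫ g, ‖polyFluxField κ d' p (cubicProfile a₀ a₁ a₂ a₃) (tiedProfile τ a₀ a₁ a₂ a₃) (r • su2Quat g)‖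
          ∂haarProbability (Matrix.specialUnitaryGroup (Fin 2) ℂ)) =
    |p| * (∫ r in (0:ℝ)..1, r ^ 4 * ∫ g,
        Real.exp (κ * r * (su2Quat g).re) *
          |(1 - (r * (su2Quat g).re) ^ 2) * (a₁ + 2 * a₂ * (r * (su2Quat g).re) + 3 * a₃ * (r * (su2Quat g).re) ^ 2) +
            (κ * (1 - (r * (su2Quat g).re) ^ 2) - 5 * (r * (su2Quat g).re)) *
              (a₀ + a₁ * (r * (su2Quat g).re) + a₂ * (r * (su2Quat g).re) ^ 2 + a₃ * (r * (su2Quat g).re) ^ 3) +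
            (κ * (r * (su2Quat g).re) ^ 2 + (5 - κ * τ) * (r * (su2Quat g).re) - 4 * τ)|
          ∂haarProbability (Matrix.specialUnitaryGroup (Fin 2) ℂ)) +
    ∫ r in (0:ℝ)..1, r ^ 3 * ∫ g,
        Real.exp (κ * r * (su2Quat g).re) *
          ‖profileField d' p (cubicProfile a₀ a₁ a₂ a₃) (tiedProfile τ a₀ a₁ a₂ a₃) (r • su2Quat g)‖
          ∂haarProbability (Matrix.specialUnitaryGroup (Fin 2) ℂ) := by
  set φ : ℝ → ℝ := fun t => (1 - t ^ 2) * (a₁ + 2 * a₂ * t + 3 * a₃ * t ^ 2) +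
    (κ * (1 - t ^ 2) - 5 * t) * (a₀ + a₁ * t + a₂ * t ^ 2 + a₃ * t ^ 3) + (κ * t ^ 2 + (5 - κ * τ) * t - 4 * τ) with hφ
  have hφc : Continuous φ := by rw [hφ]; fun_prop
  have hV : Continuous (profileField d' p (cubicProfile a₀ a₁ a₂ a₃) (tiedProfile τ a₀ a₁ a₂ a₃)) :=
    (contDiff_profileField d' p (contDiff_cubicProfile a₀ a₁ a₂ a₃) (contDiff_tiedProfile τ a₀ a₁ a₂ a₃)).continuous
  have hdiv : ∀ y, radialDiv (polyFluxField κ d' p (cubicProfile a₀ a₁ a₂ a₃) (tiedProfile τ a₀ a₁ a₂ a₃)) y =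
      ‖y‖ ^ 2 * Real.exp (κ * y.re) * (p * φ y.re) := by
    intro y
    rw [radialDiv_cubicFluxField, hd, mul_zero, zero_add]
  exact fluxRHS_eq_of_profile κ p hφc hV (fun y => rfl) hdiv

/-! ## 2. The λ-trick bounds -/

/-- **λ-bound for `Y(φ)`.**  For every continuous profile `φ` and every `λ > 0`:
`∫₀¹ r⁴ ∫ e^{κrx₀}|φ(rx₀)| dσ dr ≤ (λ·m₂ + H(φ)/λ)/2`, `m₂ = ∫₀¹ r⁵ ∫ e^{κrx₀} dσ dr`, `H(φ) = ∫₀¹ r³ ∫ e^{κrx₀} φ(rx₀)² dσ dr`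
(pointwise `r⁴e|a| ≤ (λr⁵e + r³ea²/λ)/2`). [folklore] -/
theorem Y_le_of_profile (κ : ℝ) {φ : ℝ → ℝ} (hφ : Continuous φ) {l : ℝ} (hl : 0 < l) :
    ∫ r in (0:ℝ)..1, r ^ 4 * ∫ g,
        Real.exp (κ * r * (su2Quat g).re) * |φ (r * (su2Quat g).re)| ∂haarProbability (Matrix.specialUnitaryGroup (Fin 2) ℂ) ≤
      (l * (∫ r in (0:ℝ)..1, r ^ 5 * ∫ g, Real.exp (κ * r * (su2Quat g).re) ∂haarProbability (Matrix.specialUnitaryGroup (Fin 2) ℂ)) +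
        (∫ r in (0:ℝ)..1, r ^ 3 * ∫ g, Real.exp (κ * r * (su2Quat g).re) *
          φ (r * (su2Quat g).re) ^ 2 ∂haarProbability (Matrix.specialUnitaryGroup (Fin 2) ℂ)) / l) / 2 := by
  have hq := cq2
  have hp := cp2
  have cY := continuous_integral₂ (F := fun r (g : Matrix.specialUnitaryGroup (Fin 2) ℂ) =>
    Real.exp (κ * r * (su2Quat g).re) * |φ (r * (su2Quat g).re)|) (by fun_prop)
  have c0 := continuous_integral₂ (F := fun r (g : Matrix.specialUnitaryGroup (Fin 2) ℂ) => Real.exp (κ * r * (su2Quat g).re)) (by fun_prop)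
  have cH := continuous_integral₂ (F := fun r (g : Matrix.specialUnitaryGroup (Fin 2) ℂ) => Real.exp (κ * r * (su2Quat g).re) *
    φ (r * (su2Quat g).re) ^ 2) (by fun_prop)
  have hpt : ∀ r ∈ Set.Icc (0:ℝ) 1, r ^ 4 * ∫ g,
        Real.exp (κ * r * (su2Quat g).re) * |φ (r * (su2Quat g).re)| ∂haarProbability (Matrix.specialUnitaryGroup (Fin 2) ℂ) ≤
      (l / 2) * (r ^ 5 * ∫ g, Real.exp (κ * r * (su2Quat g).re) ∂haarProbability (Matrix.specialUnitaryGroup (Fin 2) ℂ)) +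
        (1 / (2 * l)) * (r ^ 3 * ∫ g, Real.exp (κ * r * (su2Quat g).re) *
          φ (r * (su2Quat g).re) ^ 2 ∂haarProbability (Matrix.specialUnitaryGroup (Fin 2) ℂ)) := by
    intro r hr
    have hr0 : 0 ≤ r := hr.1
    have i0 : Integrable (fun g : Matrix.specialUnitaryGroup (Fin 2) ℂ => r ^ 4 * (Real.exp (κ * r * (su2Quat g).re) *
        |φ (r * (su2Quat g).re)|)) (haarProbability (Matrix.specialUnitaryGroup (Fin 2) ℂ)) :=
      integrable_of_continuous_SUN (by fun_prop) _
    have i1 : Integrable (fun g : Matrix.specialUnitaryGroup (Fin 2) ℂ => (l / 2 * r ^ 5) * Real.exp (κ * r * (su2Quat g).re))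
        (haarProbability (Matrix.specialUnitaryGroup (Fin 2) ℂ)) :=
      integrable_of_continuous_SUN (by fun_prop) _
    have i2 : Integrable (fun g : Matrix.specialUnitaryGroup (Fin 2) ℂ => (r ^ 3 / (2 * l)) * (Real.exp (κ * r * (su2Quat g).re) *
        φ (r * (su2Quat g).re) ^ 2)) (haarProbability (Matrix.specialUnitaryGroup (Fin 2) ℂ)) :=
      integrable_of_continuous_SUN (by fun_prop) _
    have i12 : Integrable (fun g : Matrix.specialUnitaryGroup (Fin 2) ℂ => (l / 2 * r ^ 5) * Real.exp (κ * r * (su2Quat g).re) +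
        (r ^ 3 / (2 * l)) * (Real.exp (κ * r * (su2Quat g).re) * φ (r * (su2Quat g).re) ^ 2))
        (haarProbability (Matrix.specialUnitaryGroup (Fin 2) ℂ)) := i1.add i2
    rw [← integral_const_mul]
    refine (integral_mono i0 i12 fun g => ?_).trans (le_of_eq ?_)
    · have h := amgm_abs (m := r ^ 3) (ρ := r) (E := Real.exp (κ * r * (su2Quat g).re)) (a := φ (r * (su2Quat g).re))
        (pow_nonneg hr0 3) hr0 (Real.exp_pos _).le hl
      refine le_trans (le_of_eq (by ring)) (h.trans (le_of_eq ?_))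
      ring
    · rw [integral_add i1 i2, integral_const_mul, integral_const_mul]
      ring
  have iF : IntervalIntegrable (fun r : ℝ => r ^ 4 * ∫ g,
      Real.exp (κ * r * (su2Quat g).re) * |φ (r * (su2Quat g).re)| ∂haarProbability (Matrix.specialUnitaryGroup (Fin 2) ℂ))
      volume 0 1 := ((continuous_pow 4).mul cY).intervalIntegrable 0 1
  have iG1 : IntervalIntegrable (fun r : ℝ => (l / 2) * (r ^ 5 * ∫ g, Real.exp (κ * r * (su2Quat g).re)
      ∂haarProbability (Matrix.specialUnitaryGroup (Fin 2) ℂ))) volume 0 1 :=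
    (continuous_const.mul ((continuous_pow 5).mul c0)).intervalIntegrable 0 1
  have iG2 : IntervalIntegrable (fun r : ℝ => (1 / (2 * l)) * (r ^ 3 * ∫ g, Real.exp (κ * r * (su2Quat g).re) *
      φ (r * (su2Quat g).re) ^ 2 ∂haarProbability (Matrix.specialUnitaryGroup (Fin 2) ℂ))) volume 0 1 :=
    (continuous_const.mul ((continuous_pow 3).mul cH)).intervalIntegrable 0 1
  have iG : IntervalIntegrable (fun r : ℝ => (l / 2) * (r ^ 5 * ∫ g, Real.exp (κ * r * (su2Quat g).re)
      ∂haarProbability (Matrix.specialUnitaryGroup (Fin 2) ℂ)) +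
      (1 / (2 * l)) * (r ^ 3 * ∫ g, Real.exp (κ * r * (su2Quat g).re) *
        φ (r * (su2Quat g).re) ^ 2 ∂haarProbability (Matrix.specialUnitaryGroup (Fin 2) ℂ))) volume 0 1 := iG1.add iG2
  refine (intervalIntegral.integral_mono_on zero_le_one iF iG hpt).trans (le_of_eq ?_)
  rw [intervalIntegral.integral_add iG1 iG2, intervalIntegral.integral_const_mul, intervalIntegral.integral_const_mul]
  ring

/-- **λ-bound for `X(V)`.**  For every continuous field `V : ℍ → ℍ` and every `λ > 0`:
`∫₀¹ r³ ∫ e^{κrx₀}‖V(rx)‖ dσ dr ≤ (λ·z_B + Q(V)/λ)/2`, `z_B = ∫₀¹ r³ ∫ e^{κrx₀} dσ dr`, `Q(V) = ∫₀¹ r³ ∫ e^{κrx₀}‖V(rx)‖² dσ dr`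
(pointwise `e‖v‖ ≤ (λe + e‖v‖²/λ)/2`). [folklore] -/
theorem X_le_of_field (κ : ℝ) {V : ℍ → ℍ} (hV : Continuous V) {l : ℝ} (hl : 0 < l) :
    ∫ r in (0:ℝ)..1, r ^ 3 * ∫ g,
        Real.exp (κ * r * (su2Quat g).re) * ‖V (r • su2Quat g)‖ ∂haarProbability (Matrix.specialUnitaryGroup (Fin 2) ℂ) ≤
      (l * (∫ r in (0:ℝ)..1, r ^ 3 * ∫ g, Real.exp (κ * r * (su2Quat g).re) ∂haarProbability (Matrix.specialUnitaryGroup (Fin 2) ℂ)) +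
        (∫ r in (0:ℝ)..1, r ^ 3 * ∫ g, Real.exp (κ * r * (su2Quat g).re) *
          ‖V (r • su2Quat g)‖ ^ 2 ∂haarProbability (Matrix.specialUnitaryGroup (Fin 2) ℂ)) / l) / 2 := by
  have hq1 := cq1
  have hq := cq2
  have hp1 := cp1
  have hp := cp2
  have hVc : Continuous fun p : ℝ × Matrix.specialUnitaryGroup (Fin 2) ℂ => V (p.1 • su2Quat p.2) :=
    hV.comp (continuous_fst.smul hp1)
  have hVr : ∀ r : ℝ, Continuous fun g : Matrix.specialUnitaryGroup (Fin 2) ℂ => V (r • su2Quat g) := fun r =>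
    hV.comp (hq1.const_smul r)
  have cX := continuous_integral₂ (F := fun r (g : Matrix.specialUnitaryGroup (Fin 2) ℂ) =>
    Real.exp (κ * r * (su2Quat g).re) * ‖V (r • su2Quat g)‖) (by fun_prop)
  have c0 := continuous_integral₂ (F := fun r (g : Matrix.specialUnitaryGroup (Fin 2) ℂ) => Real.exp (κ * r * (su2Quat g).re)) (by fun_prop)
  have cQ := continuous_integral₂ (F := fun r (g : Matrix.specialUnitaryGroup (Fin 2) ℂ) =>
    Real.exp (κ * r * (su2Quat g).re) * ‖V (r • su2Quat g)‖ ^ 2) (by fun_prop)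
  have hpt : ∀ r ∈ Set.Icc (0:ℝ) 1, r ^ 3 * ∫ g,
        Real.exp (κ * r * (su2Quat g).re) * ‖V (r • su2Quat g)‖ ∂haarProbability (Matrix.specialUnitaryGroup (Fin 2) ℂ) ≤
      (l / 2) * (r ^ 3 * ∫ g, Real.exp (κ * r * (su2Quat g).re) ∂haarProbability (Matrix.specialUnitaryGroup (Fin 2) ℂ)) +
        (1 / (2 * l)) * (r ^ 3 * ∫ g, Real.exp (κ * r * (su2Quat g).re) *
          ‖V (r • su2Quat g)‖ ^ 2 ∂haarProbability (Matrix.specialUnitaryGroup (Fin 2) ℂ)) := by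
    intro r hr
    have hr0 : 0 ≤ r := hr.1
    have hVg := hVr r
    have i0 : Integrable (fun g : Matrix.specialUnitaryGroup (Fin 2) ℂ => r ^ 3 * (Real.exp (κ * r * (su2Quat g).re) *
        ‖V (r • su2Quat g)‖)) (haarProbability (Matrix.specialUnitaryGroup (Fin 2) ℂ)) :=
      integrable_of_continuous_SUN (by fun_prop) _
    have i1 : Integrable (fun g : Matrix.specialUnitaryGroup (Fin 2) ℂ => (l / 2 * r ^ 3) * Real.exp (κ * r * (su2Quat g).re))
        (haarProbability (Matrix.specialUnitaryGroup (Fin 2) ℂ)) :=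
      integrable_of_continuous_SUN (by fun_prop) _
    have i2 : Integrable (fun g : Matrix.specialUnitaryGroup (Fin 2) ℂ => (r ^ 3 / (2 * l)) * (Real.exp (κ * r * (su2Quat g).re) *
        ‖V (r • su2Quat g)‖ ^ 2)) (haarProbability (Matrix.specialUnitaryGroup (Fin 2) ℂ)) :=
      integrable_of_continuous_SUN (by fun_prop) _
    have i12 : Integrable (fun g : Matrix.specialUnitaryGroup (Fin 2) ℂ => (l / 2 * r ^ 3) * Real.exp (κ * r * (su2Quat g).re) +
        (r ^ 3 / (2 * l)) * (Real.exp (κ * r * (su2Quat g).re) * ‖V (r • su2Quat g)‖ ^ 2))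
        (haarProbability (Matrix.specialUnitaryGroup (Fin 2) ℂ)) := i1.add i2
    rw [← integral_const_mul]
    refine (integral_mono i0 i12 fun g => ?_).trans (le_of_eq ?_)
    · have h := amgm_abs (m := r ^ 3) (ρ := 1) (E := Real.exp (κ * r * (su2Quat g).re)) (a := ‖V (r • su2Quat g)‖)
        (pow_nonneg hr0 3) zero_le_one (Real.exp_pos _).le hl
      rw [abs_of_nonneg (norm_nonneg _)] at h
      refine le_trans (le_of_eq (by ring)) (h.trans (le_of_eq ?_))
      ring
    · rw [integral_add i1 i2, integral_const_mul, integral_const_mul]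
      ring
  have iF : IntervalIntegrable (fun r : ℝ => r ^ 3 * ∫ g,
      Real.exp (κ * r * (su2Quat g).re) * ‖V (r • su2Quat g)‖ ∂haarProbability (Matrix.specialUnitaryGroup (Fin 2) ℂ))
      volume 0 1 := ((continuous_pow 3).mul cX).intervalIntegrable 0 1
  have iG1 : IntervalIntegrable (fun r : ℝ => (l / 2) * (r ^ 3 * ∫ g, Real.exp (κ * r * (su2Quat g).re)
      ∂haarProbability (Matrix.specialUnitaryGroup (Fin 2) ℂ))) volume 0 1 :=
    (continuous_const.mul ((continuous_pow 3).mul c0)).intervalIntegrable 0 1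
  have iG2 : IntervalIntegrable (fun r : ℝ => (1 / (2 * l)) * (r ^ 3 * ∫ g, Real.exp (κ * r * (su2Quat g).re) *
      ‖V (r • su2Quat g)‖ ^ 2 ∂haarProbability (Matrix.specialUnitaryGroup (Fin 2) ℂ))) volume 0 1 :=
    (continuous_const.mul ((continuous_pow 3).mul cQ)).intervalIntegrable 0 1
  have iG : IntervalIntegrable (fun r : ℝ => (l / 2) * (r ^ 3 * ∫ g, Real.exp (κ * r * (su2Quat g).re)
      ∂haarProbability (Matrix.specialUnitaryGroup (Fin 2) ℂ)) +
      (1 / (2 * l)) * (r ^ 3 * ∫ g, Real.exp (κ * r * (su2Quat g).re) *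
        ‖V (r • su2Quat g)‖ ^ 2 ∂haarProbability (Matrix.specialUnitaryGroup (Fin 2) ℂ))) volume 0 1 := iG1.add iG2
  refine (intervalIntegral.integral_mono_on zero_le_one iF iG hpt).trans (le_of_eq ?_)
  rw [intervalIntegral.integral_add iG1 iG2, intervalIntegral.integral_const_mul, intervalIntegral.integral_const_mul]
  ring

end Summit.Ventures.YMGap.PolyFluxLambda
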